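import Mathlib
import HarnessLib
import Summits.HubbardSuperconductivity.HubbardSuperconductivity.Theorems.KLProgrammeKLRegimeEngineTowerRemeasureNarrowWideSplit

/-!
# Route `KLProgramme` — crux K3 ENGINE (stmt-HubbardSuperconductivity-20437 `KLRegimeEngineV17F2`), stub (b) v2, THE LEVELS PACKAGE (ℓ), (I2) jump half:
# THE NARROW / WIDE SPLIT ROW ON E1's TOWER ARRAYS — the increment `Δ_{k′}` re-measured at `F_{dk−1}` with the on-class loss against the FULLY PRESCRIBED born array
# (located item «ON-CLASS-KB», consumer side, tower-row instance; cell gate-hubbard-kl, seat hubbard-kl-k3c2-p3 g11)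

`…EngineTowerRemeasureLev` (p588868) instantiates the plain levelled jump on E1's tower data (`klLevNormOf_klTowerIncr_remeasure_le_klEng`: increment `klTowerIncr … d k′`
born at `F_{dk′}`, read at `F_{dk−1}`, size `klTowerBornLev … d k′ (m+1) F`).  This file does the same for the narrow / wide split of `…EngineTowerRemeasureNarrowWideSplit`
(p619303): BOTH the off-class and the on-class data are E1's EXISTING array `klTowerBornLev` — at the read level `F = levelCount Ωe` off the class, and at the FULL level `m + 1` on the
narrow class (E1-LEVELS-BLUEPRINT-g8 §2: `b₂ k p F` with `gain(J, F) = (2^{−J})^{levelGainExp F}`, maximal at `F = m+1`) — so «ON-CLASS-KB» needs NO new carrier on the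
levelled track:

**`klLevNormOf_klTowerIncr_narrowWideSplit_le_klEng m (hm : 3 ≤ m)`** — constants as in `klLevNormOf_jump_le_narrowWideSplit_klEng`; for `2 ≤ d`, `k′ < k`, `k₀ ≤ dk′`,
`dk − 1 ≤ nScales β + 1`, a transversality radius `Θ` in the wide regime at `(k, J′) := (dk′, dk−1)` and the three scale conditions at `dk′`:
`klLevNormOf … (dk−1) (m+1) Δ_{k′} Ωe ≤ C_m·(27^{F+1}·(D₁^{m+1} + 5^{m+1}(m+1)²·B_fib·3^{m−2})·(2^{dk−1−dk′})^{m−2}·klTowerBornLev … d k′ (m+1) F`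
`+ D₂·27^{m+1}·(2^{dk−1−dk′})^{m−F}·Mult·klTowerBornLev … d k′ (m+1) (m+1))`.
Proof only; nothing about the model is asserted; nothing asserts superconductivity.
References: BGM 2006 §2.8 (2.82)–(2.84), (2.88)–(2.90), App. A3 [cite: BenfattoGiulianiMastropietro2006].
-/

noncomputable section

namespace Summit.HubbardSuperconductivity.HubbardSuperconductivity.Theorems.EngineV8

set_option linter.dupNamespace false -- summit = problem name (single-conjunct summit), D-0017

open Classical
open Real Finset Literature.MathematicalPhysics.QuantumLattice Literature.Probability.LatticeModels GrassmannAlgebra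
open Literature.MathematicalPhysics.QuantumLattice.FermiRG
open Summit.HubbardSuperconductivity.HubbardSuperconductivity.Theorems.KLRegimeSplit
open Summit.HubbardSuperconductivity.HubbardSuperconductivity.Theorems.KLProgrammeLegKernels
open Summit.HubbardSuperconductivity.HubbardSuperconductivity.Theorems.DispersionFlow
open Summit.HubbardSuperconductivity.HubbardSuperconductivity.Theorems.PerturbedFermiCurve

variable {L M : ℕ} [NeZero L] [NeZero M]

/-- **THE INCREMENT `Δ_{k′}` RE-MEASURED AT `F_{dk−1}`, NARROW / WIDE SPLIT, ON E1's ARRAYS** (`m + 1 ≥ 4` legs): off the class the born array at the read level,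
on the narrow class the born array at the FULL level `m + 1` times the narrow multiplicity.
[cite: BenfattoGiulianiMastropietro2006, §2.8 (2.82)-(2.84), (2.88)-(2.90), App. A3] -/
theorem klLevNormOf_klTowerIncr_narrowWideSplit_le_klEng (m : ℕ) (hm : 3 ≤ m) :
    ∃ Cm : ℝ, 0 < Cm ∧ ∃ C : ℝ, 0 < C ∧ ∃ D₁ : ℝ, 0 < D₁ ∧ ∃ Cw : ℝ, 0 < Cw ∧
      ∃ c₂ cb K₁ K₂ c₀ c₂' : ℝ, 0 ≤ c₂ ∧ 0 < cb ∧ 2 + c₂ ≤ K₁ ∧ 0 < K₂ ∧ 0 < c₀ ∧ 0 < c₂' ∧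
      ∃ D₂ : ℝ, 0 < D₂ ∧ ∃ k₀ : ℕ,
      ∀ R : RenConsts, R.WF2 → ∃ c₃ : ℝ, 0 < c₃ ∧ ∃ U₀ : ℝ, 0 < U₀ ∧ ∃ Λ : ℝ, 0 ≤ Λ ∧ ∃ r₀ : ℝ, 0 < r₀ ∧ ∃ v₀ : ℝ, 0 < v₀ ∧
      ∀ (P : SplitConsts) (c : ℝ), P.WF → 0 < c → c ≤ klEngC₃6 P R → c ≤ c₃ →
      ∀ μ ∈ klWindowC, ∀ U : ℝ, 0 < U → U ≤ klEngU₀9 P R c → U ≤ U₀ → ∀ β : ℝ, klBetaMin ≤ β → β ≤ Real.exp (c / U ^ 2) →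
      ∀ K : TrigPolyC4v, FrameOK R U (nScales β) μ K → ∀ (L M : ℕ) [NeZero L] [NeZero M],
      klEngL₃ β U ≤ L → klEngM₃ β U L ≤ M → ∀ d k k' : ℕ, 2 ≤ d → k' < k → k₀ ≤ d * k' → d * k - 1 ≤ nScales β + 1 →
      ∀ (Θ LΨ Bfib : ℝ), LΨ = (m + 1 : ℕ) + c₂ * (π / 2 + 5 * sectorWidth (d * k')) / (K₁ * Θ) → (2 : ℝ) ^ (-((d * k - 1 : ℕ) : ℤ)) ≤ Θ →
        cb * (2 : ℝ) ^ (-((d * k - 1 : ℕ) : ℤ)) ≤ Θ → K₂ * LΨ * (cb * (2 : ℝ) ^ (-((d * k - 1 : ℕ) : ℤ))) ≤ c₂' * Θ →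
        max ((2 * ((2 * c₀ * K₂ * cb / π + 1) * LΨ)) ^ 2) (4 * cb ^ 2 * K₂ ^ 2 / 1 ^ 2 * LΨ ^ 2) ≤ Bfib →
      ((m : ℝ) + 1) * (Cw + C) * sectorWidth (d * k') < 2 * π →
      (((m : ℝ) + 1) * C + m * Λ * (⌊(Θ + 5 * sectorWidth (d * k')) / sectorWidth (d * k')⌋₊ : ℕ)) * sectorWidth (d * k') < v₀ →
      ((m : ℝ) + 1) * C * sectorWidth (d * k') < π →
      ∀ Ωe : Fin (m + 1) → Option (SectorLeg (sectorCount (d * k - 1))),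
        klLevNormOf L M β μ K (d * k - 1) (m + 1) (klTowerIncr L M β U μ K d k') Ωe ≤
          Cm * ((27 : ℝ) ^ (levelCount Ωe + 1) * (D₁ ^ (m + 1) + (5 : ℝ) ^ (m + 1) * ((m + 1 : ℕ) ^ 2 * (Bfib * 3 ^ (m - 2)))) *
              ((2 : ℝ) ^ (d * k - 1 - d * k')) ^ (m - 2) * klTowerBornLev L M β U μ K d k' (m + 1) (levelCount Ωe) +
            D₂ * 27 ^ (m + 1) * ((2 : ℝ) ^ (d * k - 1 - d * k')) ^ (m - levelCount Ωe) *
              ((2 * ((m : ℝ) + 1) + 1) ^ 2 * (2 * (8 * π * (((m : ℝ) + 1) * C + m * Λ *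
                (⌊(Θ + 5 * sectorWidth (d * k')) / sectorWidth (d * k')⌋₊ : ℕ)) / r₀ + 2) *
                (8 * (2 * ((⌊(Θ + 5 * sectorWidth (d * k')) / sectorWidth (d * k')⌋₊ : ℕ) : ℝ) + 1)) ^ m)) *
              klTowerBornLev L M β U μ K d k' (m + 1) (m + 1)) := by
  obtain ⟨Cm, hCm, C, hC, D₁, hD₁, Cw, hCw, c₂, cb, K₁, K₂, c₀, c₂', h1, h2, h3, h4, h5, h6, D₂, hD₂, k₀, h⟩ :=
    klLevNormOf_jump_le_narrowWideSplit_klEng m hm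
  refine ⟨Cm, hCm, C, hC, D₁, hD₁, Cw, hCw, c₂, cb, K₁, K₂, c₀, c₂', h1, h2, h3, h4, h5, h6, D₂, hD₂, k₀, fun R hR2 => ?_⟩
  obtain ⟨c₃, hc₃, U₀, hU₀, Λ, hΛ, r₀, hr₀, v₀, hv₀, h'⟩ := h R hR2
  refine ⟨c₃, hc₃, U₀, hU₀, Λ, hΛ, r₀, hr₀, v₀, hv₀, ?_⟩
  intro P c hP hc hc6 hcm μ hμ U hU hU9 hUm β hβmin hβc K hK L M _ _ hL3 hM3 d k k' hd hk hk₀ hkN Θ LΨ Bfib hLΨ hΘt hΘδ hΘη hBfib hsmall hsmallv hπC Ωe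
  have hβ : 0 < β := KLRegimeSplit.pos_of_klBetaMin_le hβmin
  exact h' P c hP hc hc6 hcm μ hμ U hU hU9 hUm β hβmin hβc K hK L M hL3 hM3 (d * k') (d * k - 1) hk₀ (block_jump_le hd hk) hkN Θ LΨ Bfib hLΨ hΘt hΘδ hΘη
    hBfib hsmall hsmallv hπC (klTowerIncr L M β U μ K d k') (fun m' X hX => klTowerIncr_momentumConserving β U μ K d k' m' X hX) Ωe
    (klTowerBornLev L M β U μ K d k' (m + 1) (levelCount Ωe)) (klTowerBornLev L M β U μ K d k' (m + 1) (m + 1))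
    (klTowerBornLev_nonneg hβ.le U μ K d k' (m + 1) _) (klTowerBornLev_nonneg hβ.le U μ K d k' (m + 1) _)
    (fun Ωe' hlev => by rw [← hlev]; exact klLevNormOf_le_klTowerBornLev β U μ K d k' (m + 1) Ωe')
    (fun Ωf hlev => by
      have hh := klLevNormOf_le_klTowerBornLev (L := L) (M := M) β U μ K d k' (m + 1) Ωf
      rwa [hlev] at hh)

end Summit.HubbardSuperconductivity.HubbardSuperconductivity.Theorems.EngineV8

end
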